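import Summits.ValiantsHypothesis.ValiantsHypothesis.Theorems.KPlusLogSqLawStaticPathMixedEventsCount
import Summits.ValiantsHypothesis.ValiantsHypothesis.Theorems.KPlusLogSqLawStaticPathMixedEventsTips

/-!
# Route «KPlusLogSqLaw» — parametric max-weight independent set on a path: THEOREM T — at most `2n` MIXED events (part 3, conclusion)

HONEST FRAMING.  Helper toward the crux `WeakLifting` (item `stmt-ValiantsHypothesis-19561`, route `KPlusLogSqLaw`, cell `pub-symmetroid`,
seat val-sym-lift-p4 g20, 2026-08-29) on the line of its witness-plan stub `stub_tridiagonalSectorB` (tropical twin of the STATIC tridiagonal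
sector = parametric maximum-weight independent set on a path = Eppstein's parametric closure problem on the fence).  Kernel form of the
lineage's THEOREM T (val-sym-lift-p4 g14, `HOME/val-sym-lift-p4/THEOREM-T.md`, paper proof, verified numerically there on all maximisers
`n ≤ 30` and random instances), in the ORDER-TYPE form of the event criterion (val-sym-lift-p4 g16 `EVENT-CRITERION.md` Theorem 1 /
`THEOREM-T.md` §5): for lines `L t θ = a t θ + b t`, `t = 0..n`, in general position (pairwise distinct slopes, no three concurrent), a MIXED
EVENT is a pair `p < q ≤ n` with `p + q` odd such that (M) every line with index strictly between `p` and `q` is strictly on its correct side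
of the vertex `L p ∩ L q` (even lines ABOVE, odd lines BELOW — the camps of `gap`), and (L)/(R) the maximal runs of correct lines `p-1, p-2, …`
and `q+1, q+2, …, n` both have EVEN length.  THEOREM (`mixedEvents_card_le`): there are at most `2n` mixed events.  Along a generic sweep of
`θ` these are exactly the breakpoints of the parametric maximum-weight independent set on the path (items `w_t = (-1)^t (L t - L (t-1))`) at
which the optimal set changes SIZE — pair creations and annihilations of vacancies —, so the SIZE of the optimum changes at most `2n` times; the
same-parity «hops» are the open half of the ORDER QUESTION, which stays open (kernel `O(n log n)`, located `2n - 4`).  Proof: left-type events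
(odd line flatter) ≤ `n` by the counting lemma `card_le_of_unique_tips` (part 1) fed with `leftTip_unique` / `leftTip_between` (part 2);
right-type events are the left-type events of the reflected arrangement `θ ↦ -θ` (`tip_reflect`); every mixed event is of one of the two types.
Statements about a labelled line arrangement; nothing here asserts anything about `WeakLifting`, `TropicalB`, `KPlusLogSqLaw`, the stub in
its window, `MatrixDescartes` (stmt-ValiantsHypothesis-18050) or `VP ≠ VNP`.
-/

set_option linter.dupNamespace false
set_option autoImplicit false

namespace Summit.ValiantsHypothesis.ValiantsHypothesis.Theorems.KPlusLogSqLaw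

open Finset Classical

namespace StaticPathFold

noncomputable section

variable (a b : ℕ → ℝ)

/-! ## 5. THEOREM T -/

/-- **THEOREM T (val-sym-lift-p4 g14; kernel form).**  For lines `L t θ = a t θ + b t`, `t = 0, …, n`, with pairwise distinct slopes and no three
concurrent, the MIXED EVENTS — pairs `p < q ≤ n` with `p + q` odd such that (M) every line strictly between `p` and `q` is strictly on its
correct side of the vertex `L p ∩ L q` (even lines above, odd lines below), (L) the maximal run of correct lines `p-1, p-2, …` has even length and
(R) the maximal run of correct lines `q+1, …, n` has even length — number at most `2n`.  (EVENT-CRITERION Theorem 1: these are the breakpoints of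
the parametric maximum-weight independent set on the path at which the optimal set changes SIZE — pair creations and annihilations; THEOREM-T.md.)
Left-type events (odd line flatter) are at most `n` by `card_le_of_unique_tips` with `leftTip_unique` / `leftTip_between`; right-type events
are left-type events of the reflected arrangement. [folklore] -/
theorem mixedEvents_card_le (n : ℕ) (hslope : ∀ p q, p ≤ n → q ≤ n → p ≠ q → a p ≠ a q)
    (hgp : ∀ p q t, p ≤ n → q ≤ n → t ≤ n → p ≠ q → t ≠ p → t ≠ q →
      L a b t ((b q - b p) / (a p - a q)) ≠ L a b p ((b q - b p) / (a p - a q))) :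
    (((range (n + 1)) ×ˢ (range (n + 1))).filter (fun pq : ℕ × ℕ => pq.1 < pq.2 ∧ pq.2 ≤ n ∧ Odd (pq.1 + pq.2) ∧
        (∀ t, pq.1 < t → t < pq.2 →
          0 < gap t (L a b pq.1 ((b pq.2 - b pq.1) / (a pq.1 - a pq.2))) (L a b t ((b pq.2 - b pq.1) / (a pq.1 - a pq.2)))) ∧
        (∃ r, Even r ∧ r ≤ pq.1 ∧
          (∀ t, pq.1 - r ≤ t → t < pq.1 →
            0 < gap t (L a b pq.1 ((b pq.2 - b pq.1) / (a pq.1 - a pq.2))) (L a b t ((b pq.2 - b pq.1) / (a pq.1 - a pq.2)))) ∧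
          (r = pq.1 ∨ ¬ 0 < gap (pq.1 - r - 1) (L a b pq.1 ((b pq.2 - b pq.1) / (a pq.1 - a pq.2)))
            (L a b (pq.1 - r - 1) ((b pq.2 - b pq.1) / (a pq.1 - a pq.2))))) ∧
        (∃ r, Even r ∧ pq.2 + r ≤ n ∧
          (∀ t, pq.2 < t → t ≤ pq.2 + r →
            0 < gap t (L a b pq.1 ((b pq.2 - b pq.1) / (a pq.1 - a pq.2))) (L a b t ((b pq.2 - b pq.1) / (a pq.1 - a pq.2)))) ∧
          (pq.2 + r = n ∨ ¬ 0 < gap (pq.2 + r + 1) (L a b pq.1 ((b pq.2 - b pq.1) / (a pq.1 - a pq.2)))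
            (L a b (pq.2 + r + 1) ((b pq.2 - b pq.1) / (a pq.1 - a pq.2))))))).card ≤ 2 * n := by
  -- correctness predicate and the two types
  set G : ℕ → ℕ → ℕ → Prop := fun p q t =>
    0 < gap t (L a b p ((b q - b p) / (a p - a q))) (L a b t ((b q - b p) / (a p - a q))) with hG
  -- left type (odd line flatter): at most `n`
  have hL : (((range (n + 1)) ×ˢ (range (n + 1))).filter (fun pq : ℕ × ℕ => pq.1 < pq.2 ∧ pq.2 ≤ n ∧
        (Odd (pq.1 + pq.2) ∧ (if Even pq.1 then a pq.2 < a pq.1 else a pq.1 < a pq.2)) ∧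
        (∀ t, pq.1 < t → t < pq.2 → G pq.1 pq.2 t) ∧
        (∃ r, Even r ∧ r ≤ pq.1 ∧ (∀ t, pq.1 - r ≤ t → t < pq.1 → G pq.1 pq.2 t) ∧ (r = pq.1 ∨ ¬ G pq.1 pq.2 (pq.1 - r - 1))) ∧
        (∃ r, Even r ∧ pq.2 + r ≤ n ∧ (∀ t, pq.2 < t → t ≤ pq.2 + r → G pq.1 pq.2 t) ∧
          (pq.2 + r = n ∨ ¬ G pq.1 pq.2 (pq.2 + r + 1))))).card ≤ n := by
    have key := card_le_of_unique_tips n G (fun p q => Odd (p + q) ∧ (if Even p then a q < a p else a p < a q))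
      (fun p q h => h.1)
      (fun i j p q p' q' h1 h2 h3 h4 h5 h1' h2' h3' h4' h5' =>
        leftTip_unique a b i j p q p' q' h1 h2 h3 h4.1 h4.2 h5 h1' h2' h3' h4'.1 h4'.2 h5')
      (fun i j₁ j₂ j₃ h12 h23 h3n h1 h3 => leftTip_between a b n hslope hgp i j₁ j₂ j₃ h12 h23 h3n h1 h3)
    convert key using 4
  -- right type (odd line steeper): at most `n`, by the reflection `θ ↦ -θ`
  set a' : ℕ → ℝ := fun s => -a s with ha'
  have ha'' : ∀ s, a' s = -a s := fun s => rfl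
  have hslope' : ∀ p q, p ≤ n → q ≤ n → p ≠ q → a' p ≠ a' q :=
    fun p q hp hq hpq h => hslope p q hp hq hpq (neg_injective h)
  have hgp' : ∀ p q t, p ≤ n → q ≤ n → t ≤ n → p ≠ q → t ≠ p → t ≠ q →
      L a' b t ((b q - b p) / (a' p - a' q)) ≠ L a' b p ((b q - b p) / (a' p - a' q)) := by
    intro p q t hp hq ht hpq htp htq h
    apply hgp p q t hp hq ht hpq htp htq
    have h1 := gap_reflect a b a' ha'' p q t
    have h2 := gap_reflect a b a' ha'' p q p
    unfold gap at h1 h2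
    split_ifs at h1 h2 <;> linarith
  have hR : (((range (n + 1)) ×ˢ (range (n + 1))).filter (fun pq : ℕ × ℕ => pq.1 < pq.2 ∧ pq.2 ≤ n ∧
        (Odd (pq.1 + pq.2) ∧ (if Even pq.1 then a pq.1 < a pq.2 else a pq.2 < a pq.1)) ∧
        (∀ t, pq.1 < t → t < pq.2 → G pq.1 pq.2 t) ∧
        (∃ r, Even r ∧ r ≤ pq.1 ∧ (∀ t, pq.1 - r ≤ t → t < pq.1 → G pq.1 pq.2 t) ∧ (r = pq.1 ∨ ¬ G pq.1 pq.2 (pq.1 - r - 1))) ∧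
        (∃ r, Even r ∧ pq.2 + r ≤ n ∧ (∀ t, pq.2 < t → t ≤ pq.2 + r → G pq.1 pq.2 t) ∧
          (pq.2 + r = n ∨ ¬ G pq.1 pq.2 (pq.2 + r + 1))))).card ≤ n := by
    have key := card_le_of_unique_tips n G (fun p q => Odd (p + q) ∧ (if Even p then a p < a q else a q < a p))
      (fun p q h => h.1)
      (fun i j p q p' q' h1 h2 h3 h4 h5 h1' h2' h3' h4' h5' => by
        have hh := (tip_reflect a b a' ha'' i j p q).mpr ⟨h1, h2, h3, h4, h5⟩
        have hh' := (tip_reflect a b a' ha'' i j p' q').mpr ⟨h1', h2', h3', h4', h5'⟩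
        exact leftTip_unique a' b i j p q p' q' hh.1 hh.2.1 hh.2.2.1 hh.2.2.2.1.1 hh.2.2.2.1.2 hh.2.2.2.2
          hh'.1 hh'.2.1 hh'.2.2.1 hh'.2.2.2.1.1 hh'.2.2.2.1.2 hh'.2.2.2.2)
      (fun i j₁ j₂ j₃ h12 h23 h3n h1 h3 => by
        obtain ⟨p₁, q₁, hh₁⟩ := h1
        obtain ⟨p₃, q₃, hh₃⟩ := h3
        obtain ⟨p, q, hh⟩ := leftTip_between a' b n hslope' hgp' i j₁ j₂ j₃ h12 h23 h3n
          ⟨p₁, q₁, (tip_reflect a b a' ha'' i j₁ p₁ q₁).mpr hh₁⟩ ⟨p₃, q₃, (tip_reflect a b a' ha'' i j₃ p₃ q₃).mpr hh₃⟩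
        exact ⟨p, q, (tip_reflect a b a' ha'' i j₂ p q).mp hh⟩)
    convert key using 4
  -- every mixed event is of left or of right type
  refine le_trans (card_le_card ?_) ((card_union_le _ _).trans ((add_le_add hL hR).trans (by omega)))
  intro pq hpq
  rw [mem_union, mem_filter, mem_filter]
  rw [mem_filter] at hpq
  obtain ⟨hP, h1, h2, h3, h4, h5, h6⟩ := hpq
  have hne : a pq.1 ≠ a pq.2 := hslope _ _ (by omega) h2 (by omega)
  by_cases he : Even pq.1
  · rcases lt_or_gt_of_ne hne with h | h
    · right; exact ⟨hP, h1, h2, ⟨h3, by rw [if_pos he]; exact h⟩, h4, h5, h6⟩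
    · left; exact ⟨hP, h1, h2, ⟨h3, by rw [if_pos he]; exact h⟩, h4, h5, h6⟩
  · rcases lt_or_gt_of_ne hne with h | h
    · left; exact ⟨hP, h1, h2, ⟨h3, by rw [if_neg he]; exact h⟩, h4, h5, h6⟩
    · right; exact ⟨hP, h1, h2, ⟨h3, by rw [if_neg he]; exact h⟩, h4, h5, h6⟩

end

end StaticPathFold

end Summit.ValiantsHypothesis.ValiantsHypothesis.Theorems.KPlusLogSqLaw
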